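import Summits.AtomisticToContinuum.FouriersLaw.Theses.OddSectorIrreversibility
import Literature.Barriers.AtomisticToContinuum.MazurBoundBallisticOpenChain
import Literature.MathematicalPhysics.KineticTheory.PhaseSpacePoisson
import Literature.MathematicalPhysics.KineticTheory.LangevinChainGibbs

/-!
# `ConeScaleCorrector` (E1), line `gamblers-ruin-defect`: stub `stub_generatorLeftEnergy`

Registered sub-stub (fixed N, pure calculus): the generator identity `L E_L = w_L − J_tot/(N−1)`,
`E_L = H − X/(N−1)`, for the pinned chain at equal bath temperatures.

Route: `L = {H, ·} + taps` (`generator_eq_poisson_add_taps`), `{H, H} = 0` (`poisson_self`),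
`{H, X} = J_tot` (`sum_bondCurrent_eq_poisson`), and the taps of `E_L` are explicit:
`∂_{p_i} E_L = (1 − i/(N−1)) p_i`, `∂²_{p_i} E_L = 1 − i/(N−1)`, which vanish at the right contact
`i = N − 1` and equal `p_0`, `1` at the left contact `i = 0`.
-/

noncomputable section

open MeasureTheory ProbabilityTheory Filter Topology Set
open scoped ENNReal NNReal BigOperators
open Literature.MathematicalPhysics.KineticTheory.HeatConduction
open Literature.MathematicalPhysics.KineticTheory.HeatConduction.OscillatorChain
open Literature.Barriers.AtomisticToContinuum.OpenChain

namespace Summit.AtomisticToContinuum.FouriersLaw.Theorems.OddSectorIrreversibility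

/-- The energy first moment `X = energyMoment P N` is as smooth as the potentials. [folklore] -/
theorem contDiff_energyMoment_of_contDiff (P : OscillatorChain) {n : WithTop ℕ∞} {N : ℕ}
    (hU : ContDiff ℝ n P.U) (hV : ContDiff ℝ n P.V) : ContDiff ℝ n (energyMoment P N) := by
  -- adapted from Cruxes/ConeScaleCorrector/FirstLemmaIdeator1.lean (`contDiff_energyMoment`)
  unfold energyMoment
  have hq : ∀ i : Fin N, ContDiff ℝ n fun x : PhaseSpace N => x.1 i := fun i =>
    (contDiff_apply ℝ ℝ i).comp contDiff_fst
  have hp : ∀ i : Fin N, ContDiff ℝ n fun x : PhaseSpace N => x.2 i := fun i =>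
    (contDiff_apply ℝ ℝ i).comp contDiff_snd
  apply ContDiff.add
  · exact ContDiff.sum fun i _ => contDiff_const.mul ((((hp i).pow 2).div_const 2).add (hU.comp (hq i)))
  · refine ContDiff.sum fun i _ => ContDiff.sum fun j _ => ?_
    by_cases h : j.val = i.val + 1
    · simp only [h, if_true]
      exact contDiff_const.mul (hV.comp ((hq j).sub (hq i)))
    · simp only [h, if_false]
      exact contDiff_const

/-- The Langevin generator is the Liouville operator `{H, ·}` plus the two Ornstein–Uhlenbeck taps
at the contacts `i = 0` (temperature `T_L`) and `i = N − 1` (temperature `T_R`). [folklore] -/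
theorem generator_eq_poisson_add_taps (P : OscillatorChain) (N : ℕ) (T_L T_R : ℝ)
    (f : PhaseSpace N → ℝ) (x : PhaseSpace N) :
    P.generator N T_L T_R f x = poisson (P.hamiltonian N) f x +
      P.γ * ∑ i : Fin N,
        ((if i.val = 0 then T_L * partialP i (partialP i f) x - x.2 i * partialP i f x else 0) +
          (if i.val = N - 1 then T_R * partialP i (partialP i f) x - x.2 i * partialP i f x else 0)) := by
  -- adapted from Cruxes/ConeScaleCorrector/FirstLemmaIdeator1.lean (`generator_eq_poisson_add_taps`)
  unfold OscillatorChain.generator poisson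
  simp only [partialP_hamiltonian]

/-- `∂_{p_i} (c p_i) = c`. [folklore] -/
theorem partialP_const_mul_snd_self {N : ℕ} (i : Fin N) (c : ℝ) (x : PhaseSpace N) :
    partialP i (fun y : PhaseSpace N => c * y.2 i) x = c := by
  -- adapted from Cruxes/ConeScaleCorrector/FirstLemmaIdeator1.lean (`partialP_snd_self`)
  unfold partialP
  simp only [Function.update_self]
  rw [deriv_const_mul_field, deriv_id'', mul_one]

/-- **stub_generatorLeftEnergy** (FIXED `N ≥ 2`; size S–M; pure calculus; registered sub-stub of
`stub_correctorSplitting`, lead reshape 2026-08-16). The generator identity `L E_L = w_L − J_tot/(N−1)` for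
`E_L = H − X/(N−1)` (`X = energyMoment`), `w_L = γ(T − p₀²)` written as a sum over `i = 0`, at equal bath
temperatures and for EVERY real parameter value (no positivity needed). PROVED in the crux workfile
`Cruxes/ConeScaleCorrector/FirstLemmaIdeator1.lean` (`generator_leftWeightedEnergy`, via `leftWeightedEnergy_eq :
leftWeightedEnergy = H − X/(N−1)`, `generator_eq_poisson_add_taps`, `poisson_self`, `sum_bondCurrent_eq_poisson`,
`partialP_hamiltonian`, `partialP_energyMoment`); to be re-landed under `Theorems/` (crux workfiles are not importable). -/
theorem stub_generatorLeftEnergy :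
    ∀ ω₂ lam β γ T : ℝ, ∀ N : ℕ, 2 ≤ N → ∀ x : PhaseSpace N,
    (pinnedChain ω₂ lam β γ).generator N T T
        (fun y : PhaseSpace N => (pinnedChain ω₂ lam β γ).hamiltonian N y
          - energyMoment (pinnedChain ω₂ lam β γ) N y / ((N : ℝ) - 1)) x =
      (∑ i : Fin N, if i.val = 0 then γ * (T - x.2 i ^ 2) else 0)
        - (1 / ((N : ℝ) - 1)) * ∑ i : Fin N, (pinnedChain ω₂ lam β γ).bondCurrent N i x := by
  -- adapted from Cruxes/ConeScaleCorrector/FirstLemmaIdeator1.lean (`generator_leftWeightedEnergy`)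
  intro ω₂ lam β γ T N hN x
  set P := pinnedChain ω₂ lam β γ with hP
  set c : ℝ := 1 / ((N : ℝ) - 1) with hc
  have hU : ContDiff ℝ (⊤ : WithTop ℕ∞) P.U := pinnedChain_contDiff_U ω₂ lam β γ
  have hV : ContDiff ℝ (⊤ : WithTop ℕ∞) P.V := pinnedChain_contDiff_V ω₂ lam β γ
  have hHs : ContDiff ℝ (⊤ : WithTop ℕ∞) (P.hamiltonian N) := P.contDiff_hamiltonian hU hV N
  have hXs : ContDiff ℝ (⊤ : WithTop ℕ∞) (energyMoment P N) := contDiff_energyMoment_of_contDiff P hU hV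
  have hH : Differentiable ℝ (P.hamiltonian N) := hHs.differentiable (by simp)
  have hX : Differentiable ℝ (energyMoment P N) := hXs.differentiable (by simp)
  have hUd : Differentiable ℝ P.U := hU.differentiable (by simp)
  have hVd : Differentiable ℝ P.V := hV.differentiable (by simp)
  have hcX : Differentiable ℝ (fun y : PhaseSpace N => (-c) * energyMoment P N y) := hX.const_mul _
  -- `E_L = H + (-c) X` as functions
  have hE : (fun y : PhaseSpace N => P.hamiltonian N y - energyMoment P N y / ((N : ℝ) - 1)) =
      (P.hamiltonian N) + fun y => (-c) * energyMoment P N y := by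
    funext y
    simp only [Pi.add_apply, hc]
    ring
  rw [hE]
  set E : PhaseSpace N → ℝ := (P.hamiltonian N) + fun y => (-c) * energyMoment P N y with hEdef
  -- first p-derivatives of E_L
  have hd1 : ∀ i : Fin N, partialP i E = fun y : PhaseSpace N => (1 + (-c) * (i.val : ℝ)) * y.2 i := by
    intro i; funext y
    rw [hEdef, partialP_add hH hcX, partialP_const_mul, partialP_hamiltonian, partialP_energyMoment]
    ring
  -- second p-derivatives of E_L
  have hd2 : ∀ i : Fin N, ∀ y : PhaseSpace N, partialP i (partialP i E) y = 1 + (-c) * (i.val : ℝ) := by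
    intro i y
    rw [hd1 i, partialP_const_mul_snd_self]
  -- Poisson part: {H, E_L} = {H, H} + (-c) {H, X} = -c J_tot
  have hpois : poisson (P.hamiltonian N) E x = (-c) * ∑ i : Fin N, P.bondCurrent N i x := by
    rw [hEdef, poisson_add_right _ hH hcX, poisson_self, poisson_const_mul_right,
      ← sum_bondCurrent_eq_poisson P hUd hVd N x, zero_add]
  rw [generator_eq_poisson_add_taps, hpois]
  -- taps: only the left one survives
  have hN1 : ((N : ℝ) - 1) ≠ 0 := by
    have : (2 : ℝ) ≤ N := by exact_mod_cast hN
    linarith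
  have htap : ∀ i : Fin N,
      ((if i.val = 0 then T * partialP i (partialP i E) x - x.2 i * partialP i E x else 0) +
        (if i.val = N - 1 then T * partialP i (partialP i E) x - x.2 i * partialP i E x else 0)) =
      (if i.val = 0 then (T - x.2 i ^ 2) else 0) := by
    intro i
    rw [hd2 i, hd1 i]
    by_cases h0 : i.val = 0
    · have hne : i.val ≠ N - 1 := by omega
      rw [if_pos h0, if_neg hne, if_pos h0]
      have hcast0 : ((i.val : ℕ) : ℝ) = 0 := by rw [h0]; simp
      rw [hcast0]
      ring
    · rw [if_neg h0, if_neg h0, zero_add]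
      by_cases h1 : i.val = N - 1
      · rw [if_pos h1]
        have hcast : ((i.val : ℕ) : ℝ) = (N : ℝ) - 1 := by
          rw [h1, Nat.cast_sub (by omega)]; simp
        have hzero : 1 + (-c) * (i.val : ℝ) = 0 := by
          rw [hcast, hc]; field_simp; ring
        rw [hzero]; ring
      · rw [if_neg h1]
  rw [Finset.sum_congr rfl fun i _ => htap i]
  -- assemble: `P.γ = γ`
  have hγ : P.γ = γ := rfl
  have hsum : P.γ * ∑ i : Fin N, (if i.val = 0 then T - x.2 i ^ 2 else 0) =
      ∑ i : Fin N, (if i.val = 0 then γ * (T - x.2 i ^ 2) else 0) := by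
    rw [Finset.mul_sum]
    refine Finset.sum_congr rfl fun i _ => ?_
    rw [hγ]
    split_ifs <;> ring
  rw [hsum]
  ring

end Summit.AtomisticToContinuum.FouriersLaw.Theorems.OddSectorIrreversibility
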